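import Summits.BirchSwinnertonDyer.BirchSwinnertonDyer.Theorems.KatoDescentPotSupersingularUnitIndexMuDoorsFukudaAt
import HarnessLib

/-!
# K9 `WildCoatesSujathaResidue` (19942) / node 19189 / item 19197 — FUKUDA at ANY pair of consecutive layers `(n, n+1)` on the
# maximal real subfield `ℚ(P) = ℚ(W[3])^c` of a **`3Nn`** row (image `= C_ns⁺(3)`): (A) at `(W,3)` / U₀ doors, class-number form
# (Thm. 1 (1)) and `p`-rank form (Thm. 1 (2)) — the NON-SPLIT twins of `…UnitIndexMuDoorsFukudaAt` §4
# (cell `bsd-potss`, seat `bsd-potss-k9-c4` g20; route-free; `--supports` 19197; closes nothing)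

HONEST FRAMING. THEOREMS ONLY (no definition, no named fact, no `sorry`), one-step compositions of LANDED theorems (g18's
`CartanMuRoadRealDoors.{conjA,missingUpperBoundAt}_three_of_hasModPImageEqNonsplitCartanNormalizer_of_realMu'` — ONE classical
`μ`-hypothesis on `ℚ(P)`, paying Iwasawa's growth theorem `hI` — and the tree corollaries `classicalMuVanishes_of_classNumberPExp_succ_eq` /
`classicalMuVanishes_of_classGroupPRank_succ_eq` of the NAMED FACTS Fukuda 1994 Thm. 1 (1) / (2)). Per-row DOORS whose numeric hypotheses
(`hram`: Fukuda index `0`; `hord`: `e_{n+1} = e_n`; `hrk`: `rank_{n+1} = rank_n`) are displayed and certified per row by PARI/GP; CONDITIONAL on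
the named facts; (A), Conjecture A and BSD proved for NO curve; items stay OPEN class-wide (open input: zeta crux 24327).
WHY. The last `3Nn` residue row of K9's Conj-A crux without a discharged `μ`-hypothesis is `406593q1` (g19 census v4.1: `K⁺ = ℚ(P)` octic,
`s = 5`, unit-symbol rank `2 < 4` — unit-index door shut; `e₀ = 0 → e₁ = 2` — Fukuda (0,1) shut); kit j309392 (`--workitem 19197`, degree-`72`
layer `2`, running at the time of writing) decides Fukuda at `(1, 2)`: `e₂ = e₁` feeds `…_of_realSuccEqAt`, `rank₂ = rank₁` feeds
`…_of_realRankSuccEqAt` (both with `n = 1`). The `3Ns` twins (split Cartan) are g19's; this file only supplies the missing non-split shape.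

References: [Fukuda1994] Thm. 1 (1), (2), p. 264; [Iwasawa1959] §; [CoatesSujatha2005] Thm. 3.4; [Kato2004Asterisque] Thm. 14.5 (3); [Serre1972] §2.2,
§5.2; [Washington1997] §13.1.
-/

set_option linter.dupNamespace false
set_option autoImplicit false

noncomputable section

open scoped NumberField
open Field IntermediateField WeierstrassCurve IsDedekindDomain Literature.NumberTheory.EllipticCurves
  Literature.NumberTheory.GaloisRepresentations Literature.NumberTheory.SerreUniformity
  Literature.NumberTheory.IwasawaTheory Literature.NumberTheory.EllipticCurves.Rank1Residual.Typed
  Summit.BirchSwinnertonDyer.Rank1Residual.Additive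

namespace Summit.BirchSwinnertonDyer.BirchSwinnertonDyer.Theorems.UnitIndexMuDoors

/-! ## §5 Fukuda at `(n, n+1)` on `ℚ(P) = ℚ(W[3])^c` for the NON-SPLIT Cartan-normaliser rows (`3Nn`) -/

section FukudaAtNonsplit

variable (W : WeierstrassCurve ℚ) [W.IsElliptic]

set_option synthInstance.maxHeartbeats 400000 in
set_option maxHeartbeats 4000000 in
/-- **(A) at `(W,3)` on a `3Nn` row from FUKUDA Thm. 1 (1) at layers `(n, n+1)` on `ℚ(P) = ℚ(W[3])^c`** (modulo `hCS`, Iwasawa's growth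
theorem `hI`, `hFW`, `hF1`): image `= C_ns⁺(3)` (`himg`), a complex conjugation `c`, and for every cyclotomic `ℤ_3`-extension of
`Kp = ℚ(W[3])^c`: Fukuda index `0` (`hram`) and `ord₃ h(Kp_{n+1}) = ord₃ h(Kp_n)` (`hord`) — then `μ = 0`
(`classicalMuVanishes_of_classNumberPExp_succ_eq`) and g18's one-field door applies. CONDITIONAL; nothing booked.
[cite: Fukuda1994, Thm. 1 (1), p. 264] [cite: CoatesSujatha2005, Thm. 3.4 (§3)] [cite: Serre1972, §2.2, §5.2 (iv)] [cite: Washington1997, §13.1] -/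
theorem conjA_three_of_hasModPImageEqNonsplitCartanNormalizer_of_realSuccEqAt
    (hCS : CoatesSujatha2005.thm34_fineSelmerDual_moduleFinite_of_classicalMuVanishes_divisionField)
    (hI : iwasawa1959_classNumberPExp_growth) (hFW : ferreroWashington1979_classicalMuVanishes)
    (hF1 : fukuda1994_thm1_classNumberPExp_const_of_succ_eq)
    (himg : HasModPImageEqNonsplitCartanNormalizer W 3)
    {c : absoluteGaloisGroup ℚ} (hc : IsComplexConjugation (Rat.castHom ℝ) c)
    (Kp : IntermediateField ℚ ↥(W.divisionField 3)) (hKp : Kp = fixedField (Subgroup.zpowers (absRestrictNormalHom (W.divisionField 3) c)))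
    (n : ℕ) (hram : ∀ κE : ZpExtension ↥Kp 3, κE.IsCyclotomic → TotallyRamifiedFrom κE 0)
    (hord : ∀ κE : ZpExtension ↥Kp 3, κE.IsCyclotomic → classNumberPExp κE (n + 1) = classNumberPExp κE n)
    (κ : ZpExtension ℚ 3) (hκ : κ.IsCyclotomic) :
    ∃ (γ : absoluteGaloisGroup ℚ) (D : W.FineSelmerDualData κ γ),
      Module.Finite ℤ_[3] (RestrictScalars ℤ_[3] (IwasawaAlgebra 3) D.X) := by
  haveI : NumberField ↥(W.divisionField 3) := NumberField.mk
  subst hKp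
  exact CartanMuRoadRealDoors.conjA_three_of_hasModPImageEqNonsplitCartanNormalizer_of_realMu' W hCS hI hFW himg hc
    (fun κE hκE => classicalMuVanishes_of_classNumberPExp_succ_eq hF1 κE (hram κE hκE) (Nat.zero_le n) (hord κE hκE)) κ hκ

set_option synthInstance.maxHeartbeats 400000 in
set_option maxHeartbeats 4000000 in
/-- **(A) at `(W,3)` on a `3Nn` row from FUKUDA Thm. 1 (2) (`p`-RANKS) at layers `(n, n+1)` on `ℚ(P) = ℚ(W[3])^c`** (modulo `hCS`, `hI`,
`hFW` and the named fact `fukuda1994_thm1_classGroupPRank_const_of_succ_eq` `hF2`): Fukuda index `0` (`hram`) and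
`rank₃ Cl(Kp_{n+1}) = rank₃ Cl(Kp_n)` (`hrk`). CONDITIONAL; nothing booked.
[cite: Fukuda1994, Thm. 1 (2), p. 264] [cite: CoatesSujatha2005, Thm. 3.4 (§3)] [cite: Serre1972, §2.2, §5.2 (iv)] [cite: Washington1997, §13.1] -/
theorem conjA_three_of_hasModPImageEqNonsplitCartanNormalizer_of_realRankSuccEqAt
    (hCS : CoatesSujatha2005.thm34_fineSelmerDual_moduleFinite_of_classicalMuVanishes_divisionField)
    (hI : iwasawa1959_classNumberPExp_growth) (hFW : ferreroWashington1979_classicalMuVanishes)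
    (hF2 : fukuda1994_thm1_classGroupPRank_const_of_succ_eq)
    (himg : HasModPImageEqNonsplitCartanNormalizer W 3)
    {c : absoluteGaloisGroup ℚ} (hc : IsComplexConjugation (Rat.castHom ℝ) c)
    (Kp : IntermediateField ℚ ↥(W.divisionField 3)) (hKp : Kp = fixedField (Subgroup.zpowers (absRestrictNormalHom (W.divisionField 3) c)))
    (n : ℕ) (hram : ∀ κE : ZpExtension ↥Kp 3, κE.IsCyclotomic → TotallyRamifiedFrom κE 0)
    (hrk : ∀ κE : ZpExtension ↥Kp 3, κE.IsCyclotomic → classGroupPRank κE (n + 1) = classGroupPRank κE n)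
    (κ : ZpExtension ℚ 3) (hκ : κ.IsCyclotomic) :
    ∃ (γ : absoluteGaloisGroup ℚ) (D : W.FineSelmerDualData κ γ),
      Module.Finite ℤ_[3] (RestrictScalars ℤ_[3] (IwasawaAlgebra 3) D.X) := by
  haveI : NumberField ↥(W.divisionField 3) := NumberField.mk
  subst hKp
  exact CartanMuRoadRealDoors.conjA_three_of_hasModPImageEqNonsplitCartanNormalizer_of_realMu' W hCS hI hFW himg hc
    (fun κE hκE => classicalMuVanishes_of_classGroupPRank_succ_eq hF2 κE (hram κE hκE) (Nat.zero_le n) (hrk κE hκE)) κ hκ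

variable [W.IsGloballyMinimal]

set_option synthInstance.maxHeartbeats 400000 in
set_option maxHeartbeats 4000000 in
/-- **U₀ at a `3Nn` residue row from FUKUDA Thm. 1 (1) at layers `(n, n+1)` on `ℚ(P)`** (named facts {A161-fine, GZK, modularity, `hCS`, `hI`,
`hFW`, `hF1`} + displayed `hram`, `hord` about `Kp = ℚ(W[3])^c`). The shape the `406593q1` record takes if kit j309392 returns `e₂ = e₁`
(`n = 1`). CONDITIONAL; nothing booked; BSD for no curve. [cite: Kato2004Asterisque, Thm. 14.5 (3) (p. 236)]
[cite: Fukuda1994, Thm. 1 (1), p. 264] [cite: CoatesSujatha2005, Thm. 3.4 (§3)] [cite: Washington1997, §13.1] -/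
theorem missingUpperBoundAt_three_of_hasModPImageEqNonsplitCartanNormalizer_of_realSuccEqAt
    (hKatoA : Kato2004.rankZero_padicValNat_sha_add_padicValNat_tamagawa_le_of_additive_potGood_of_irreducible_of_fineSelmerDual_fg)
    (hGZK : rank_eq_analyticRank_of_analyticRank_le_one) (hmod : hasEntireLFunction_rat)
    (hCS : CoatesSujatha2005.thm34_fineSelmerDual_moduleFinite_of_classicalMuVanishes_divisionField)
    (hI : iwasawa1959_classNumberPExp_growth) (hFW : ferreroWashington1979_classicalMuVanishes)
    (hF1 : fukuda1994_thm1_classNumberPExp_const_of_succ_eq) [Fact (3 : ℕ).Prime]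
    (hr : W.analyticRank = 0) (hO : ClassO6 W 3) (hirr : W.HasIrreducibleModPGaloisRep 3)
    (himg : HasModPImageEqNonsplitCartanNormalizer W 3)
    {c : absoluteGaloisGroup ℚ} (hc : IsComplexConjugation (Rat.castHom ℝ) c)
    (Kp : IntermediateField ℚ ↥(W.divisionField 3)) (hKp : Kp = fixedField (Subgroup.zpowers (absRestrictNormalHom (W.divisionField 3) c)))
    (n : ℕ) (hram : ∀ κE : ZpExtension ↥Kp 3, κE.IsCyclotomic → TotallyRamifiedFrom κE 0)
    (hord : ∀ κE : ZpExtension ↥Kp 3, κE.IsCyclotomic → classNumberPExp κE (n + 1) = classNumberPExp κE n) :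
    MissingUpperBoundAt W 3 :=
  WildFineSelmerSupersingularCMAnchor.missingUpperBoundAt_wild_of_conjA hKatoA hGZK hmod W hr hO hirr
    (conjA_three_of_hasModPImageEqNonsplitCartanNormalizer_of_realSuccEqAt W hCS hI hFW hF1 himg hc Kp hKp n hram hord)

set_option synthInstance.maxHeartbeats 400000 in
set_option maxHeartbeats 4000000 in
/-- **U₀ at a `3Nn` residue row from FUKUDA Thm. 1 (2) (`p`-RANKS) at layers `(n, n+1)` on `ℚ(P)`** (named facts {A161-fine, GZK, modularity,
`hCS`, `hI`, `hFW`, `hF2`} + displayed `hram`, `hrk` about `Kp = ℚ(W[3])^c`). The shape the `406593q1` record takes if kit j309392 returns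
`rank₂ = rank₁` with `e₂ > e₁` (`n = 1`). CONDITIONAL; nothing booked; BSD for no curve. [cite: Kato2004Asterisque, Thm. 14.5 (3) (p. 236)]
[cite: Fukuda1994, Thm. 1 (2), p. 264] [cite: CoatesSujatha2005, Thm. 3.4 (§3)] [cite: Washington1997, §13.1] -/
theorem missingUpperBoundAt_three_of_hasModPImageEqNonsplitCartanNormalizer_of_realRankSuccEqAt
    (hKatoA : Kato2004.rankZero_padicValNat_sha_add_padicValNat_tamagawa_le_of_additive_potGood_of_irreducible_of_fineSelmerDual_fg)
    (hGZK : rank_eq_analyticRank_of_analyticRank_le_one) (hmod : hasEntireLFunction_rat)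
    (hCS : CoatesSujatha2005.thm34_fineSelmerDual_moduleFinite_of_classicalMuVanishes_divisionField)
    (hI : iwasawa1959_classNumberPExp_growth) (hFW : ferreroWashington1979_classicalMuVanishes)
    (hF2 : fukuda1994_thm1_classGroupPRank_const_of_succ_eq) [Fact (3 : ℕ).Prime]
    (hr : W.analyticRank = 0) (hO : ClassO6 W 3) (hirr : W.HasIrreducibleModPGaloisRep 3)
    (himg : HasModPImageEqNonsplitCartanNormalizer W 3)
    {c : absoluteGaloisGroup ℚ} (hc : IsComplexConjugation (Rat.castHom ℝ) c)
    (Kp : IntermediateField ℚ ↥(W.divisionField 3)) (hKp : Kp = fixedField (Subgroup.zpowers (absRestrictNormalHom (W.divisionField 3) c)))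
    (n : ℕ) (hram : ∀ κE : ZpExtension ↥Kp 3, κE.IsCyclotomic → TotallyRamifiedFrom κE 0)
    (hrk : ∀ κE : ZpExtension ↥Kp 3, κE.IsCyclotomic → classGroupPRank κE (n + 1) = classGroupPRank κE n) :
    MissingUpperBoundAt W 3 :=
  WildFineSelmerSupersingularCMAnchor.missingUpperBoundAt_wild_of_conjA hKatoA hGZK hmod W hr hO hirr
    (conjA_three_of_hasModPImageEqNonsplitCartanNormalizer_of_realRankSuccEqAt W hCS hI hFW hF2 himg hc Kp hKp n hram hrk)

end FukudaAtNonsplit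

end Summit.BirchSwinnertonDyer.BirchSwinnertonDyer.Theorems.UnitIndexMuDoors

end
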